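import Summits.CriticalPhenomena.PercolationContinuityZ3.Theorems.PercNearOneGluingNoHeavyLowerTailKnQuestion8CoefficientwiseQmixStarClass
import Summits.CriticalPhenomena.PercolationContinuityZ3.Theorems.PercNearOneGluingNoHeavyLowerTailKnQuestion8CoefficientwiseNoCoreNbhd
import HarnessLib

/-!
# The two-point exclusion at a point with a ROOT EDGE: the two unsigned `u`-star classes are ROOT-DOM wall sums — prim-lf-2 gen 51 (part 1 of 3)

Support file (`--supports stmt-CriticalPhenomena-4575`, closed), prover `prim-lf-2` (gen 51).  No definitions, no named facts, no sorries; standard axioms.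
Memo `prim-lf-2/CW-ROOTEDGE-gen51.md` §1–§2; context `prim-lf-2/CW-ANATOMY-gen49.md` §3 (the atom (♣)), `prim-lf-2/CW-TWOSOURCE-gen50.md` §1.3, §7(1) (the NO-CORE
points residue: `deg y = 2`, `N(y) = {p,q}`, both points adjacent to the root), `prim-lf-2/CW-VDBHK-gen29.md` §2 (ROOT-DOM / SUFF-A / DOM-C).

Setting.  Finite multigraph `ends : ι → Sym2 V`, root `x`, `K(s) = openCluster (ends '' s) x`; the two-point exclusion with `f = 1_u`,
`Q_mix(p,q)[1_u, g] = Σ_{s : ¬(p ∈ K s ∧ q ∈ K sᶜ)} ([u ∈ K s] − [u ∈ K sᶜ])·(g(K s) − g(K sᶜ))` (CONJECTURE Q_mix: `≥ 0`).  Resolve the star `D` of `u`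
(ALL edges at `u` are in `D`; `R ⊆ D` red): `a(r) = K(r⁺ ∪ R)`, `b(r) = K((rᶜ)⁺ ∪ (D ∖ R))` on the sub-cube `r : Finset {j // j ∉ D}`, class sum
`C_R = Σ_r [¬(p ∈ a r ∧ q ∈ b r)]·([u ∈ a r] − [u ∈ b r])·(g(a r) − g(b r))`.  When `N(u) = {p, q, x}` (`u` adjacent to the ROOT), gen 49's brackets sign every class with
an edge `up` red (`qmixStarClass_nonneg_of_red`) or with `up, uq` blue (`qmixStarClass_nonneg_of_blue_blue`); this file treats the two remaining classes:
* `qmixStarClass_ge_wallClass_of_redRoot` — if an edge `ux` is RED in the class and the blue edges `D ∖ R` all go to `p`, then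
  `C_R ≥ WC_R(p) := Σ_r [p ∉ a r][p ∉ b r]·(g(a r) − g(b r))` (a kernel `Σ [p∈a][p,q∉b](g a − g b) ≥ 0` is split off: antithetic kernel + inactive star);
* `qmixStarClass_ge_wallClass_of_blueRoot` — if an edge `ux` is BLUE in the class and the red edges `R` all go to `q`, then `C_R ≥ WC_{D∖R}(q)` (the mirror image, folded
  through `r ↦ rᶜ`);
* (part 2, `…QmixRootEdgeWall.lean`: `wallClass_ge_blueJoined_part` — `WC_R(p)` minus its `q`-blue-joined part is `≥ 0`, and the separation corollaries
  `wallClass_nonneg_of_sep`, `wallClass_pointIndicator_nonneg_of_sep`; part 3, `…QmixRootEdgeMain.lean`: the assembled Q_mix / NO-CORE theorems).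
`WC_R(p)` is exactly gen 25/29's ROOT-DOM functional `E_S[f(K) − f(K̄) | root edge red]` on the minor `G − u + xq` (wall vertex `p`, root edge `xq`): so CONJECTURE ROOT-DOM
implies CONJECTURE Q_mix at every degree-three point adjacent to the root, and (part 3, `…QmixRootEdgeMain.lean`) the whole 6-vertex residue of CONJECTURE NO-CORE for the
point functions; the separation corollaries settle the residue shapes without a `p–q` edge unconditionally.  Exact checks (prim-lf-2 code/gen51: symxi.c, wallq_allg.c,
kit51a): `WC ≥ 0` for all monotone `g` on all graphs with ≤ 6 vertices and on all 7-vertex graphs with ≤ 7 edges (2.55 M instances), 0 negatives.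
[cite: KozmaNitzan2024, Questions 8–9 (§5.5 p. 36) (context: the Question-8 pocket covariance programme)]
-/

namespace Summit.CriticalPhenomena.PercolationContinuityZ3.Theorems

open Finset Literature.Probability.Percolation

namespace Coefficientwise

variable {ι V : Type*} [Fintype ι] [DecidableEq ι] (ends : ι → Sym2 V) (x : V)

omit [Fintype ι] in
/-- **A star at an isolated vertex adds at most that vertex.**  If no edge of `T` contains `u ≠ x` and every edge of `A` has ends `{u, v₀}`, then
`C_x(T ∪ A) ⊆ C_x(T) ∪ {u}`.  [cite: KozmaNitzan2024, §5.5 (context only; elementary)] -/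
theorem openCluster_union_pendantStar_subset (T A : Finset ι) {u v₀ : V} (hT : ∀ i ∈ T, u ∉ ends i)
    (hA : ∀ i ∈ A, ends i = s(u, v₀)) (hxu : x ≠ u) :
    ∀ v ∈ openCluster (ends '' (↑(T ∪ A) : Set ι)) x, v = u ∨ v ∈ openCluster (ends '' (↑T : Set ι)) x := by
  classical
  set K₀ : Set V := openCluster (ends '' (↑T : Set ι)) x with hK₀
  have huK₀ : u ∉ K₀ := not_mem_openCluster_of_no_edge ends x T hxu hT
  set W : Set V := {v | v ∈ K₀ ∨ (v = u ∧ v₀ ∈ K₀)} with hW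
  have hxW : x ∈ W := Or.inl (mem_openCluster_self _ x)
  have hcl : ∀ a ∈ W, ∀ b, (openGraph (ends '' (↑(T ∪ A) : Set ι))).Adj a b → b ∈ W := by
    intro a ha b hab
    rw [openGraph_image_adj] at hab
    obtain ⟨⟨i, hi, hiab⟩, hne⟩ := hab
    rcases Finset.mem_union.mp hi with hiT | hiA
    · -- an edge of `T`: it avoids `u`, so `a ∈ K₀` and `b ∈ K₀`
      rcases ha with ha | ⟨rfl, _⟩
      · left
        have hadj : (openGraph (ends '' (↑T : Set ι))).Adj a b := by
          rw [openGraph_image_adj]; exact ⟨⟨i, hiT, hiab⟩, hne⟩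
        exact SimpleGraph.Reachable.trans ha hadj.reachable
      · exfalso; apply hT i hiT; rw [hiab]; exact Sym2.mem_mk_left _ _
    · -- an edge of `A`: `{a, b} = {u, v₀}`
      have hab' : s(a, b) = s(u, v₀) := by rw [← hiab, hA i hiA]
      rcases Sym2.eq_iff.mp hab' with ⟨rfl, rfl⟩ | ⟨rfl, rfl⟩
      · -- a = u, b = v₀
        rcases ha with ha | ⟨_, hv₀⟩
        · exact absurd ha huK₀
        · exact Or.inl hv₀
      · -- a = v₀, b = u
        rcases ha with ha | ⟨hvu, _⟩
        · exact Or.inr ⟨rfl, ha⟩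
        · exact absurd hvu hne
  intro v hv
  have hvW := openCluster_subset_of_adjClosed ends x (↑(T ∪ A) : Set ι) W hxW hcl hv
  rcases hvW with h | ⟨h, _⟩
  · exact Or.inr h
  · exact Or.inl h

section rootClass

variable {u p q : V} (D R : Finset ι)

open Classical in
/-- **The class with the root edge RED: `C_R ≥ WC_R(p)`.**  Let `D` be the set of ALL edges at `u` (each containing `u`), `R ⊆ D`, `eₓ ∈ R` with ends `{u, x}` (`x ≠ u`), and let every
edge of `D ∖ R` have ends `{u, p}` (`p ≠ u`), one of them being `e_p`.  Then for every vertex `q` and every monotone `g`, with `a(r) = K(r⁺ ∪ R)`, `b(r) = K((rᶜ)⁺ ∪ (D ∖ R))`: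
`Σ_r [p ∉ a r][p ∉ b r]·(g(a r) − g(b r)) ≤ Σ_r [¬(p ∈ a r ∧ q ∈ b r)]·([u ∈ a r] − [u ∈ b r])·(g(a r) − g(b r))`.
(`u ∈ a` always, `[u ∈ b] = [p ∈ b]`; the difference is `Σ [p∈a][p∉b][q∉b](g a − g b) = Σ E(g a − g a∘ᶜ) + Σ E(g a∘ᶜ − g b) ≥ 0`: antithetic kernel + `b(r) ⊆ a(rᶜ)`.)
[cite: KozmaNitzan2024, Questions 8–9 (§5.5 p. 36) (context)] -/
theorem qmixStarClass_ge_wallClass_of_redRoot (hdeg : ∀ i, u ∈ ends i → i ∈ D)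
    {eₓ : ι} (heₓ : ends eₓ = s(u, x)) (heₓR : eₓ ∈ R) (hxu : x ≠ u)
    (hP : ∀ i ∈ D \ R, ends i = s(u, p)) {e_p : ι} (he_p : e_p ∈ D \ R) (hpu : p ≠ u)
    (q : V) (g : Set V → ℝ) (hg : Monotone g) :
    ∑ r : Finset {j : ι // j ∉ D},
      (if (p ∉ openCluster (ends '' (↑(r.map (Function.Embedding.subtype _) ∪ R) : Set ι)) x ∧
            p ∉ openCluster (ends '' (↑(rᶜ.map (Function.Embedding.subtype _) ∪ (D \ R)) : Set ι)) x) then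
        (g (openCluster (ends '' (↑(r.map (Function.Embedding.subtype _) ∪ R) : Set ι)) x) -
          g (openCluster (ends '' (↑(rᶜ.map (Function.Embedding.subtype _) ∪ (D \ R)) : Set ι)) x))
      else 0) ≤
    ∑ r : Finset {j : ι // j ∉ D},
      (if ¬ (p ∈ openCluster (ends '' (↑(r.map (Function.Embedding.subtype _) ∪ R) : Set ι)) x ∧
              q ∈ openCluster (ends '' (↑(rᶜ.map (Function.Embedding.subtype _) ∪ (D \ R)) : Set ι)) x) then
        ((if u ∈ openCluster (ends '' (↑(r.map (Function.Embedding.subtype _) ∪ R) : Set ι)) x then (1 : ℝ) else 0) -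
          (if u ∈ openCluster (ends '' (↑(rᶜ.map (Function.Embedding.subtype _) ∪ (D \ R)) : Set ι)) x then (1 : ℝ) else 0)) *
        (g (openCluster (ends '' (↑(r.map (Function.Embedding.subtype _) ∪ R) : Set ι)) x) -
          g (openCluster (ends '' (↑(rᶜ.map (Function.Embedding.subtype _) ∪ (D \ R)) : Set ι)) x))
      else 0) := by
  set emb := Function.Embedding.subtype (fun j : ι => j ∉ D) with hemb
  set a : Finset {j : ι // j ∉ D} → Set V := fun r => openCluster (ends '' (↑(r.map emb ∪ R) : Set ι)) x with ha
  set a' : Finset {j : ι // j ∉ D} → Set V := fun r => openCluster (ends '' (↑(r.map emb ∪ (D \ R)) : Set ι)) x with ha'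
  change ∑ r : Finset {j : ι // j ∉ D}, (if (p ∉ a r ∧ p ∉ a' rᶜ) then (g (a r) - g (a' rᶜ)) else 0) ≤
    ∑ r : Finset {j : ι // j ∉ D}, (if ¬ (p ∈ a r ∧ q ∈ a' rᶜ) then
      ((if u ∈ a r then (1 : ℝ) else 0) - (if u ∈ a' rᶜ then (1 : ℝ) else 0)) * (g (a r) - g (a' rᶜ)) else 0)
  -- monotonicity
  have hmono_union : ∀ {r t : Finset {j : ι // j ∉ D}} (X : Finset ι), r ⊆ t → r.map emb ∪ X ⊆ t.map emb ∪ X :=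
    fun X hrt => Finset.union_subset_union (Finset.map_subset_map.mpr hrt) (le_refl X)
  have ha_mono : Monotone a := fun r t hrt => openCluster_image_mono ends (hmono_union R hrt) x
  have ha'_mono : Monotone a' := fun r t hrt => openCluster_image_mono ends (hmono_union (D \ R) hrt) x
  -- ties: `u ∈ a r` always (red root edge), `[u ∈ a' t] = [p ∈ a' t]` (blue edge to `p`)
  have hua : ∀ r, u ∈ a r := fun r =>
    (mem_openCluster_iff_of_edge ends x (r.map emb ∪ R) heₓ hxu (Finset.mem_union_right _ heₓR)).mpr (mem_openCluster_self _ x)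
  have hpa' : ∀ t, u ∈ a' t ↔ p ∈ a' t := fun t =>
    mem_openCluster_iff_of_edge ends x (t.map emb ∪ (D \ R)) (hP e_p he_p) hpu (Finset.mem_union_right _ he_p)
  -- the blue star adds at most `u`: `a' t ⊆ a t`
  have hT : ∀ (t : Finset {j : ι // j ∉ D}), ∀ i ∈ t.map emb, u ∉ ends i := by
    intro t i hi hui
    obtain ⟨hiD, _⟩ := (mem_map_subtype_iff (fun j : ι => j ∉ D) t i).mp hi
    exact hiD (hdeg i hui)
  have sub1 : ∀ t : Finset {j : ι // j ∉ D}, a' t ⊆ a t := by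
    intro t v hv
    rcases openCluster_union_pendantStar_subset ends x (t.map emb) (D \ R) (hT t) hP hxu v hv with rfl | hv'
    · exact hua t
    · exact openCluster_image_mono ends Finset.subset_union_left x hv'
  -- the kernel weight
  set E : Finset {j : ι // j ∉ D} → ℝ := fun r => if (p ∈ a r ∧ p ∉ a' rᶜ ∧ q ∉ a' rᶜ) then (1 : ℝ) else 0 with hE
  have hpt : ∀ r : Finset {j : ι // j ∉ D}, (if ¬ (p ∈ a r ∧ q ∈ a' rᶜ) then
      ((if u ∈ a r then (1 : ℝ) else 0) - (if u ∈ a' rᶜ then (1 : ℝ) else 0)) * (g (a r) - g (a' rᶜ)) else 0) =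
      (if (p ∉ a r ∧ p ∉ a' rᶜ) then (g (a r) - g (a' rᶜ)) else 0) + E r * (g (a r) - g (a' rᶜ)) := by
    intro r
    simp only [hE, hua r, hpa' rᶜ, if_true]
    by_cases h1 : p ∈ a r <;> by_cases h2 : p ∈ a' rᶜ <;> by_cases h3 : q ∈ a' rᶜ <;> simp [h1, h2, h3]
  rw [Finset.sum_congr rfl (fun r _ => hpt r), Finset.sum_add_distrib]
  -- the kernel is nonnegative
  have hE_mono : Monotone E := by
    intro r t hrt
    simp only [hE]
    by_cases hr : p ∈ a r ∧ p ∉ a' rᶜ ∧ q ∉ a' rᶜ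
    · have hc : a' tᶜ ⊆ a' rᶜ := ha'_mono (compl_subset_compl.mpr hrt)
      have ht : p ∈ a t ∧ p ∉ a' tᶜ ∧ q ∉ a' tᶜ := ⟨ha_mono hrt hr.1, fun h => hr.2.1 (hc h), fun h => hr.2.2 (hc h)⟩
      simp [hr, ht]
    · simp only [hr, if_false]; split_ifs <;> norm_num
  have hK1 : 0 ≤ ∑ r : Finset {j : ι // j ∉ D}, E r * (g (a r) - g (a rᶜ)) :=
    AntitheticProduct.sum_mul_sub_compl_nonneg E (fun r => g (a r)) hE_mono (fun r t hrt => hg (ha_mono hrt))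
  have hK2 : 0 ≤ ∑ r : Finset {j : ι // j ∉ D}, E r * (g (a rᶜ) - g (a' rᶜ)) := by
    refine Finset.sum_nonneg fun r _ => mul_nonneg ?_ ?_
    · simp only [hE]; split_ifs <;> norm_num
    · have := hg (sub1 rᶜ); linarith
  have hsplit : ∑ r : Finset {j : ι // j ∉ D}, E r * (g (a r) - g (a' rᶜ)) =
      ∑ r : Finset {j : ι // j ∉ D}, E r * (g (a r) - g (a rᶜ)) + ∑ r : Finset {j : ι // j ∉ D}, E r * (g (a rᶜ) - g (a' rᶜ)) := by
    rw [← Finset.sum_add_distrib]; refine Finset.sum_congr rfl fun r _ => ?_; ring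
  rw [hsplit]
  linarith

open Classical in
/-- **The class with the root edge BLUE: `C_R ≥ WC_{D∖R}(q)`.**  Let `D` be the set of ALL edges at `u`, `R ⊆ D`, `eₓ ∈ D ∖ R` with ends `{u, x}` (`x ≠ u`), and let every edge
of `R` have ends `{u, q}` (`q ≠ u`), one of them being `e_q`.  Then for every vertex `p` and every monotone `g`, with `a(r) = K(r⁺ ∪ R)`, `a′(r) = K(r⁺ ∪ (D ∖ R))`
(so `b(r) = a′(rᶜ)`):  `Σ_r [q ∉ a′ r][q ∉ a(rᶜ)]·(g(a′ r) − g(a(rᶜ))) ≤ C_R` — the wall sum of the complementary class `D ∖ R` at the vertex `q`.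
(`u ∈ b` always, `[u ∈ a] = [q ∈ a]`; fold through `r ↦ rᶜ`; the difference is an antithetic kernel plus the inactive star `a(t) ⊆ a′(t)`.)
[cite: KozmaNitzan2024, Questions 8–9 (§5.5 p. 36) (context)] -/
theorem qmixStarClass_ge_wallClass_of_blueRoot (hdeg : ∀ i, u ∈ ends i → i ∈ D)
    {eₓ : ι} (heₓ : ends eₓ = s(u, x)) (heₓD : eₓ ∈ D \ R) (hxu : x ≠ u)
    (hQ : ∀ i ∈ R, ends i = s(u, q)) {e_q : ι} (he_q : e_q ∈ R) (hqu : q ≠ u)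
    (p : V) (g : Set V → ℝ) (hg : Monotone g) :
    ∑ r : Finset {j : ι // j ∉ D},
      (if (q ∉ openCluster (ends '' (↑(r.map (Function.Embedding.subtype _) ∪ (D \ R)) : Set ι)) x ∧
            q ∉ openCluster (ends '' (↑(rᶜ.map (Function.Embedding.subtype _) ∪ R) : Set ι)) x) then
        (g (openCluster (ends '' (↑(r.map (Function.Embedding.subtype _) ∪ (D \ R)) : Set ι)) x) -
          g (openCluster (ends '' (↑(rᶜ.map (Function.Embedding.subtype _) ∪ R) : Set ι)) x))
      else 0) ≤
    ∑ r : Finset {j : ι // j ∉ D},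
      (if ¬ (p ∈ openCluster (ends '' (↑(r.map (Function.Embedding.subtype _) ∪ R) : Set ι)) x ∧
              q ∈ openCluster (ends '' (↑(rᶜ.map (Function.Embedding.subtype _) ∪ (D \ R)) : Set ι)) x) then
        ((if u ∈ openCluster (ends '' (↑(r.map (Function.Embedding.subtype _) ∪ R) : Set ι)) x then (1 : ℝ) else 0) -
          (if u ∈ openCluster (ends '' (↑(rᶜ.map (Function.Embedding.subtype _) ∪ (D \ R)) : Set ι)) x then (1 : ℝ) else 0)) *
        (g (openCluster (ends '' (↑(r.map (Function.Embedding.subtype _) ∪ R) : Set ι)) x) -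
          g (openCluster (ends '' (↑(rᶜ.map (Function.Embedding.subtype _) ∪ (D \ R)) : Set ι)) x))
      else 0) := by
  set emb := Function.Embedding.subtype (fun j : ι => j ∉ D) with hemb
  set a : Finset {j : ι // j ∉ D} → Set V := fun r => openCluster (ends '' (↑(r.map emb ∪ R) : Set ι)) x with ha
  set a' : Finset {j : ι // j ∉ D} → Set V := fun r => openCluster (ends '' (↑(r.map emb ∪ (D \ R)) : Set ι)) x with ha'
  change ∑ r : Finset {j : ι // j ∉ D}, (if (q ∉ a' r ∧ q ∉ a rᶜ) then (g (a' r) - g (a rᶜ)) else 0) ≤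
    ∑ r : Finset {j : ι // j ∉ D}, (if ¬ (p ∈ a r ∧ q ∈ a' rᶜ) then
      ((if u ∈ a r then (1 : ℝ) else 0) - (if u ∈ a' rᶜ then (1 : ℝ) else 0)) * (g (a r) - g (a' rᶜ)) else 0)
  have hmono_union : ∀ {r t : Finset {j : ι // j ∉ D}} (X : Finset ι), r ⊆ t → r.map emb ∪ X ⊆ t.map emb ∪ X :=
    fun X hrt => Finset.union_subset_union (Finset.map_subset_map.mpr hrt) (le_refl X)
  have ha_mono : Monotone a := fun r t hrt => openCluster_image_mono ends (hmono_union R hrt) x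
  have ha'_mono : Monotone a' := fun r t hrt => openCluster_image_mono ends (hmono_union (D \ R) hrt) x
  -- ties: `u ∈ a' t` always (blue root edge), `[u ∈ a t] = [q ∈ a t]` (red edge to `q`)
  have hua' : ∀ t, u ∈ a' t := fun t =>
    (mem_openCluster_iff_of_edge ends x (t.map emb ∪ (D \ R)) heₓ hxu (Finset.mem_union_right _ heₓD)).mpr (mem_openCluster_self _ x)
  have hqa : ∀ t, u ∈ a t ↔ q ∈ a t := fun t =>
    mem_openCluster_iff_of_edge ends x (t.map emb ∪ R) (hQ e_q he_q) hqu (Finset.mem_union_right _ he_q)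
  -- the red star adds at most `u`: `a t ⊆ a' t`
  have hT : ∀ (t : Finset {j : ι // j ∉ D}), ∀ i ∈ t.map emb, u ∉ ends i := by
    intro t i hi hui
    obtain ⟨hiD, _⟩ := (mem_map_subtype_iff (fun j : ι => j ∉ D) t i).mp hi
    exact hiD (hdeg i hui)
  have sub2 : ∀ t : Finset {j : ι // j ∉ D}, a t ⊆ a' t := by
    intro t v hv
    rcases openCluster_union_pendantStar_subset ends x (t.map emb) R (hT t) hQ hxu v hv with rfl | hv'
    · exact hua' t
    · exact openCluster_image_mono ends Finset.subset_union_left x hv'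
  -- pointwise: class summand = W⁻-summand + N·(g b − g a)
  set N : Finset {j : ι // j ∉ D} → ℝ := fun r => if (q ∉ a r ∧ q ∈ a' rᶜ ∧ p ∉ a r) then (1 : ℝ) else 0 with hN
  set E' : Finset {j : ι // j ∉ D} → ℝ := fun r => if (q ∉ a rᶜ ∧ q ∈ a' r ∧ p ∉ a rᶜ) then (1 : ℝ) else 0 with hE'
  have hpt : ∀ r : Finset {j : ι // j ∉ D}, (if ¬ (p ∈ a r ∧ q ∈ a' rᶜ) then
      ((if u ∈ a r then (1 : ℝ) else 0) - (if u ∈ a' rᶜ then (1 : ℝ) else 0)) * (g (a r) - g (a' rᶜ)) else 0) =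
      (if (q ∉ a r ∧ q ∉ a' rᶜ) then (g (a' rᶜ) - g (a r)) else 0) + N r * (g (a' rᶜ) - g (a r)) := by
    intro r
    simp only [hN, hua' rᶜ, hqa r, if_true]
    by_cases h1 : q ∈ a r <;> by_cases h2 : q ∈ a' rᶜ <;> by_cases h3 : p ∈ a r <;> simp [h1, h2, h3]
  rw [Finset.sum_congr rfl (fun r _ => hpt r), Finset.sum_add_distrib]
  -- fold both parts through `r ↦ rᶜ`
  have hfold1 : ∑ r : Finset {j : ι // j ∉ D}, (if (q ∉ a r ∧ q ∉ a' rᶜ) then (g (a' rᶜ) - g (a r)) else 0) =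
      ∑ r : Finset {j : ι // j ∉ D}, (if (q ∉ a' r ∧ q ∉ a rᶜ) then (g (a' r) - g (a rᶜ)) else 0) := by
    rw [← sum_compl_eq (fun r : Finset {j : ι // j ∉ D} => (if (q ∉ a r ∧ q ∉ a' rᶜ) then (g (a' rᶜ) - g (a r)) else 0))]
    refine Finset.sum_congr rfl fun r _ => ?_
    simp only [compl_compl]
    by_cases h1 : q ∈ a' r <;> by_cases h2 : q ∈ a rᶜ <;> simp [h1, h2]
  have hfold2 : ∑ r : Finset {j : ι // j ∉ D}, N r * (g (a' rᶜ) - g (a r)) = ∑ r : Finset {j : ι // j ∉ D}, E' r * (g (a' r) - g (a rᶜ)) := by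
    rw [← sum_compl_eq (fun r : Finset {j : ι // j ∉ D} => N r * (g (a' rᶜ) - g (a r)))]
    refine Finset.sum_congr rfl fun r _ => ?_
    have hNE : N rᶜ = E' r := by
      simp only [hN, hE', compl_compl]
    rw [hNE, compl_compl]
  rw [hfold1, hfold2]
  have hE'_mono : Monotone E' := by
    intro r t hrt
    simp only [hE']
    by_cases hr : q ∉ a rᶜ ∧ q ∈ a' r ∧ p ∉ a rᶜ
    · have hc : a tᶜ ⊆ a rᶜ := ha_mono (compl_subset_compl.mpr hrt)
      have ht : q ∉ a tᶜ ∧ q ∈ a' t ∧ p ∉ a tᶜ := ⟨fun h => hr.1 (hc h), ha'_mono hrt hr.2.1, fun h => hr.2.2 (hc h)⟩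
      simp [hr, ht]
    · simp only [hr, if_false]; split_ifs <;> norm_num
  have hK1 : 0 ≤ ∑ r : Finset {j : ι // j ∉ D}, E' r * (g (a' r) - g (a' rᶜ)) :=
    AntitheticProduct.sum_mul_sub_compl_nonneg E' (fun r => g (a' r)) hE'_mono (fun r t hrt => hg (ha'_mono hrt))
  have hK2 : 0 ≤ ∑ r : Finset {j : ι // j ∉ D}, E' r * (g (a' rᶜ) - g (a rᶜ)) := by
    refine Finset.sum_nonneg fun r _ => mul_nonneg ?_ ?_
    · simp only [hE']; split_ifs <;> norm_num
    · have := hg (sub2 rᶜ); linarith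
  have hsplit : ∑ r : Finset {j : ι // j ∉ D}, E' r * (g (a' r) - g (a rᶜ)) =
      ∑ r : Finset {j : ι // j ∉ D}, E' r * (g (a' r) - g (a' rᶜ)) + ∑ r : Finset {j : ι // j ∉ D}, E' r * (g (a' rᶜ) - g (a rᶜ)) := by
    rw [← Finset.sum_add_distrib]; refine Finset.sum_congr rfl fun r _ => ?_; ring
  rw [hsplit]
  linarith

end rootClass

end Coefficientwise

end Summit.CriticalPhenomena.PercolationContinuityZ3.Theorems
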